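import Summits.QuantumFields.BalabanUV.Beta.SpineRootedStep
import Literature.MathematicalPhysics.QuantumFieldTheory.Balaban1983to89.Beta.BalabanStepW2

/-!
# `BalabanUV.Beta.SpineRootedW2` — (P7′) ρ2, part D: the ROOTED second-order family `WbalAtOf ρ` and the rooted dressed family
# `JsBalW2AtOf ρ := JsBalAtOf ρ … (WbalAtOf ρ …)` (twins of `BalabanStepW2` §1–§3 with an1's ROOTED averaging tables)

Cell result of NEAR-MISS CELL 7 (Bałaban 4D lattice YM UV stability), β sub-cell, lineage an2 (background-field route), generation 11.
HONEST FRAMING: discharging `BetaPertH` makes Bałaban's UV stability UNCONDITIONAL — a real constructive-QFT result; it is NOT the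
continuum limit and NOT the Clay problem.  This file asserts nothing about Bałaban's manuscripts: every declaration is a definition or a
kernel-checked lemma about the definitions (no `[cite:]` is claimed; placement under `Summits/` per the cell's (R34)).

WHAT.  `BalabanStepW2` builds the second-order table family `WbalOf j := W2SymOfK (KInvStep Lc j) Lc (Spure j) (M1 j) (T₂ j) (M2Of mixFF j)`
and the dressed family `JsBalW2Of := JsBalOf … (WbalOf …) …` over the CORNER-rooted first-order spine (`vhS = vhSAt 0`, `hessFF = hessFFAt 0`)
and the corner-rooted dressing `dress = dressAt 0`.  Here every root-dependent ingredient is threaded with ONE root `ρ = toSite r`,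
`r ∈ box (d+1) Lc`:
* `SpureAt ρ j` — member `0`: `cE • wilsonA + cVH • mfNeg (vhSAt ρ)`; member `j+1`: `(cE·wE) • e3AtOf ρ (j+1) + (cVH·wVH) • mfNeg (vhSAt ρ)`;
* `M1At ρ j μ w := (cΛ·wM1 j) • hessFFAt ρ Lc μ w`;
* `WbalAtOf ρ T₂ mixFF j := W2SymOfK (KInvStep Lc j) Lc (SpureAt ρ j) (M1At ρ j) (T₂ j) (M2Of mixFF j)` — the resolvent `KInvStep`, the
  weights and the weighting `M2Of` of the binder table are ROOT-FREE and reused BY NAME;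
* `JsBalW2AtOf hLc hr … := SpineRooted.JsBalAtOf hLc hr cE cVH cΛ (WbalAtOf …) (CwAtOf …) (δwAtOf …) …` — the rooted dressed family of
  part C at the rooted second-order tables: ONE root for the tables AND the axial dressing.
Lemmas: `locStencil_SpureAt`, `SpureAt_translate`, `vertexFamily_M1At`, `M1At_translate`, `WbalAtOf_swap`, `vertexFamily₂_WbalAtOf'`
(the `loc₂` socket, packaged as `CwAtOf/δwAtOf/δwAtOf_pos/WbalAtOf_loc₂`), `WbalAtOf_translate` ((Wt) from the joint covariance of the binder
tables), `JsBalW2AtOf_S_translate` / `JsBalW2AtOf_W_translate`; BRIDGES `SpureAt_zero`, `M1At_zero`, `WbalAtOf_zero` to the corner-rooted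
objects of `BalabanStepW2` (so nothing already landed is touched or restated).

NOT here: the recursive tables `T2AtOf ρ` and the plug of an1's rooted binder tables (part E, `SpineRootedT2`).
-/

open Finset
open scoped BigOperators
open Literature.MathematicalPhysics.QuantumFieldTheory
open Literature.MathematicalPhysics.QuantumFieldTheory.Balaban1983to89
open Literature.MathematicalPhysics.QuantumFieldTheory.Balaban1983to89.Beta
open LatticeForm (quo proj_add_zsmul)
open BlochFibreUniqueness (quo_add_zsmul)
open B12Sec2to5 (l1 l1_nonneg)
open ExpKernelCalculus (Decays BiLoc VertexFamily VertexFamily₂ shiftK Zl Zl_nonneg l1_sub_triangle l1_sub_symm)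
open OneStepResolventKernel (Fib LocStencil JetData KInv decays_KInv shiftK_KInv biLoc_mono biLoc_finset_sum)
open AffineAveraging (Form1 Form2 box toSite)
open StepJetData (wilsonA wBound locStencil_wilsonA wilsonA_translate wilsonA_antisymm mfNeg mfNeg_shiftK locStencil_mfNeg
  mfNeg_antisymm locStencil_add locStencil_smul biLoc_smul biLoc_weaken l1_add_le)
open AveragingHessianKernels (vhS hessFF ell)
open AveragingHessianKernelsRooted (vhSAt locStencil_vhSAt vhSAt_translate vhSAt_symm hessFFAt hessFFAt_antisymm biLoc_hessFFAt
  hessFFAt_translate vhSAt_zero hessFFAt_zero)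
open InterLevelTransport (SLam locStencil_SLam SLam_translate cwsum avgLift biLoc_avgLift avgLift_shiftK)
open BalabanStepJets (lamCoeffOf abs_lamCoeffOf_le lamCoeffOf_translate cwsum_antisymm locStencil_mono vertexFamily₂_mono S0)
open ExpKernelCalculus (MKer comp comp_shiftK)
open OneStepResolventKernel (decays_mono vertexOf vertexFamily_vertexOf')
open OneStepKernelFamily (KInvStep decays_KInvStep shiftK_KInvStep TstepOf TbalOf)
open BalabanStepJetsSucc (mmRead E2 e3Of decays_E2 one_le_pow_Lc locStencil_e3Of lamCoeffK abs_lamCoeffK_le wE wVH wΛ Sstep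
  vertexOf_translate_block comp_sandwich_shiftK mmRead_shiftK_smul shiftK_E2 lamCoeffK_translate biLoc_comp_right biLoc_mmRead decays_mmRead)
open Summit.QuantumFields.BalabanUV.Beta.AxialDressingRooted (dressAt dressAt_S dressAt_W dressAtS_translate dressAtW_translate)
open BalabanCompositeJets (LocStencil₂)
open BalabanStepW2 (wM1 wM2 M2Of locStencilFM_M2Of M2Of_translate Spure M1 WbalOf Spure_zero Spure_succ)
open SecondOrderResponse (W2SymOfK W2SymOfK_swap LocStencilFM vertexFamily₂_W2SymOfK' W2SymOfK_translate)

noncomputable section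

namespace Summit.QuantumFields.BalabanUV.Beta.SpineRooted

variable {d : ℕ}

/-! ## §D1 The rooted Lagrangian-chart tables `SpureAt ρ j` (field) and `M1At ρ j` (multiplier) -/

section Tables

variable (d) (Lc : ℕ) [NeZero Lc]

/-- [folklore] **THE ROOTED UNFOLDED FIRST FIELD STENCIL OF THE STEP-`j` OPERATOR** (twin of `BalabanStepW2.Spure` with an1's `vhSAt ρ`
and the rooted third jet `e3AtOf ρ`): member `0` = `cE • wilsonA + cVH • mfNeg (vhSAt ρ)`, member `j+1` =
`(cE·wE (j+1)) • e3AtOf ρ (j+1) + (cVH·wVH (j+1)) • mfNeg (vhSAt ρ)`. -/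
def SpureAt (ρ : Fin (d + 1) → ℤ) (cE cVH cΛ : ℝ) : ℕ → Fin (d + 1) → (Fin (d + 1) → ℤ) → ExpKernelCalculus.MKer (d + 1) (Fib d)
  | 0 => fun κ' u' => cE • wilsonA d κ' u' + cVH • mfNeg (vhSAt ρ d Lc rfl κ' u')
  | j + 1 => fun κ' u' =>
      (cE * wE d Lc (j + 1)) • e3AtOf d Lc ρ cE cVH cΛ (j + 1) κ' u' + (cVH * wVH d Lc (j + 1)) • mfNeg (vhSAt ρ d Lc rfl κ' u')

/-- [folklore] **THE ROOTED FIRST MULTIPLIER TABLE** (twin of `BalabanStepW2.M1` with an1's `hessFFAt ρ`):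
`M1At ρ j μ w := (cΛ·wM1 j) • hessFFAt ρ Lc μ w`. -/
def M1At (ρ : Fin (d + 1) → ℤ) (cΛ : ℝ) (j : ℕ) : Fin (d + 1) → (Fin (d + 1) → ℤ) → ExpKernelCalculus.MKer (d + 1) (Fib d) :=
  fun μ w => (cΛ * wM1 d Lc j) • hessFFAt ρ Lc μ w

variable {d Lc}

/-- [folklore] Level `0` of the rooted PURE first-order table: `cE • wilsonA + cVH • mfNeg (vhSAt ρ …)` (no Lagrange border). -/
@[simp] theorem SpureAt_zero_level (ρ : Fin (d + 1) → ℤ) (cE cVH cΛ : ℝ) :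
    SpureAt d Lc ρ cE cVH cΛ 0 = fun κ' u' => cE • wilsonA d κ' u' + cVH • mfNeg (vhSAt ρ d Lc rfl κ' u') := rfl

/-- [folklore] Level `j+1` of the rooted PURE first-order table: the weighted `e3AtOf` stencil plus the weighted rooted `vhSAt` border. -/
@[simp] theorem SpureAt_succ (ρ : Fin (d + 1) → ℤ) (cE cVH cΛ : ℝ) (j : ℕ) :
    SpureAt d Lc ρ cE cVH cΛ (j + 1) = fun κ' u' =>
      (cE * wE d Lc (j + 1)) • e3AtOf d Lc ρ cE cVH cΛ (j + 1) κ' u' + (cVH * wVH d Lc (j + 1)) • mfNeg (vhSAt ρ d Lc rfl κ' u') :=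
  rfl

/-- [folklore] **BRIDGE:** at the corner root, `SpureAt 0 j = BalabanStepW2.Spure j` (`vhSAt_zero`, `e3AtOf_zero`). -/
theorem SpureAt_zero (cE cVH cΛ : ℝ) : ∀ j : ℕ, SpureAt d Lc 0 cE cVH cΛ j = Spure d Lc cE cVH cΛ j
  | 0 => by rw [SpureAt_zero_level, Spure_zero, vhSAt_zero]
  | j + 1 => by rw [SpureAt_succ, Spure_succ, vhSAt_zero, e3AtOf_zero]

omit [NeZero Lc] in
/-- [folklore] **BRIDGE:** at the corner root, `M1At 0 j = BalabanStepW2.M1 j` (`hessFFAt_zero`). -/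
theorem M1At_zero (cΛ : ℝ) (j : ℕ) : M1At d Lc 0 cΛ j = M1 d Lc cΛ j := by
  funext μ w
  simp only [M1At, M1, hessFFAt_zero]

/-- [folklore] **`SpureAt (toSite r) j` IS A LOCAL STENCIL FAMILY** at some positive rate (member `0`: `locStencil_wilsonA` and an1's
`locStencil_vhSAt`; member `j+1`: `locStencil_e3AtOf` and the same border at its rate). -/
theorem locStencil_SpureAt (hLc : 1 ≤ Lc) {r : Fin (d + 1) → ℕ} (hr : r ∈ box (d + 1) Lc) (cE cVH cΛ : ℝ) :
    ∀ j : ℕ, ∃ Cs δ : ℝ, 0 < δ ∧ LocStencil (SpureAt d Lc (toSite r) cE cVH cΛ j) Cs δ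
  | 0 => by
    have h1 : LocStencil (wilsonA d) (wBound d * Real.exp (4 * 1)) 1 := locStencil_wilsonA zero_le_one
    have h2 : LocStencil (fun κ' u => mfNeg (vhSAt (toSite r) d Lc rfl κ' u))
        (3 * (ell (d + 1) Lc : ℝ) ^ 2 * Real.exp (4 * ((d : ℝ) + 1) * Lc * 1)) 1 :=
      locStencil_mfNeg (locStencil_vhSAt hLc hr zero_le_one)
    rw [SpureAt_zero_level]
    exact ⟨_, 1, one_pos, locStencil_add (locStencil_smul cE h1) (locStencil_smul cVH h2)⟩
  | j + 1 => by
    obtain ⟨C₁, δ₁, hδ₁, h1⟩ := locStencil_e3AtOf (d := d) (Lc := Lc) hLc hr cE cVH cΛ (j + 1)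
    have h2 : LocStencil (fun κ' u => mfNeg (vhSAt (toSite r) d Lc rfl κ' u))
        (3 * (ell (d + 1) Lc : ℝ) ^ 2 * Real.exp (4 * ((d : ℝ) + 1) * Lc * δ₁)) δ₁ :=
      locStencil_mfNeg (locStencil_vhSAt hLc hr hδ₁.le)
    rw [SpureAt_succ]
    exact ⟨_, δ₁, hδ₁, locStencil_add (locStencil_smul (cE * wE d Lc (j + 1)) h1) (locStencil_smul (cVH * wVH d Lc (j + 1)) h2)⟩

/-- [folklore] **(St♭) FOR `SpureAt ρ`** (all roots): `SpureAt ρ j κ′ (u + Lc•t) = shiftK (−Lc•t) (SpureAt ρ j κ′ u)`. -/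
theorem SpureAt_translate (ρ : Fin (d + 1) → ℤ) (hLc : 1 ≤ Lc) (cE cVH cΛ : ℝ) :
    ∀ (j : ℕ) (κ' : Fin (d + 1)) (u t : Fin (d + 1) → ℤ),
      SpureAt d Lc ρ cE cVH cΛ j κ' (u + (Lc : ℤ) • t) = shiftK (-((Lc : ℤ) • t)) (SpureAt d Lc ρ cE cVH cΛ j κ' u)
  | 0, κ', u, t => by
    have h1 := wilsonA_translate (d := d) κ' u ((Lc : ℤ) • t)
    have h2 := vhSAt_translate (d := d) ρ hLc κ' u t
    funext x z a b
    simp only [SpureAt_zero_level, Pi.add_apply, Pi.smul_apply, smul_eq_mul, shiftK]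
    rw [h1, h2, mfNeg_shiftK]
    rfl
  | j + 1, κ', u, t => by
    have h1 := e3AtOf_translate (d := d) ρ hLc cE cVH cΛ j κ' u ((Lc : ℤ) • t)
    have h2 := vhSAt_translate (d := d) ρ hLc κ' u t
    funext x z a b
    simp only [SpureAt_succ, Pi.add_apply, Pi.smul_apply, smul_eq_mul, shiftK]
    rw [h1, h2, mfNeg_shiftK]
    rfl

omit [NeZero Lc] in
/-- [folklore] **`M1At (toSite r) j` IS A VERTEX FAMILY** at blocking `Lc`, every rate `δ ≥ 0` (an1's `biLoc_hessFFAt`). -/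
theorem vertexFamily_M1At (hLc : 1 ≤ Lc) {r : Fin (d + 1) → ℕ} (hr : r ∈ box (d + 1) Lc) (cΛ : ℝ) (j : ℕ) {δ : ℝ}
    (hδ : 0 ≤ δ) :
    VertexFamily (M1At d Lc (toSite r) cΛ j) Lc
      (|cΛ * wM1 d Lc j| * (2 * (ell (d + 1) Lc : ℝ) ^ 2 * Real.exp (4 * ((d : ℝ) + 1) * Lc * δ))) δ :=
  fun μ w => biLoc_smul (biLoc_hessFFAt hLc μ w hr hδ) (cΛ * wM1 d Lc j)

omit [NeZero Lc] in
/-- [folklore] **COARSE-TRANSLATION COVARIANCE OF `M1At ρ`** (all roots): `M1At ρ j μ (w + t) = shiftK (−Lc•t) (M1At ρ j μ w)`. -/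
theorem M1At_translate (ρ : Fin (d + 1) → ℤ) (cΛ : ℝ) (j : ℕ) (μ : Fin (d + 1)) (w t : Fin (d + 1) → ℤ) :
    M1At d Lc ρ cΛ j μ (w + t) = shiftK (-((Lc : ℤ) • t)) (M1At d Lc ρ cΛ j μ w) := by
  funext x z a b
  simp only [M1At, Pi.smul_apply, smul_eq_mul, shiftK]
  rw [hessFFAt_translate ρ μ w t]
  rfl

end Tables

/-! ## §D2 The rooted second-order family `WbalAtOf ρ` over the two table binders, and its `loc₂` socket -/

section Family

variable (d) (Lc : ℕ) [NeZero Lc]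

/-- [folklore] **THE ROOTED SECOND-ORDER TABLE FAMILY OF BAŁABAN'S STEP JETS** (twin of `BalabanStepW2.WbalOf`):
`WbalAtOf ρ T₂ mixFF j := W2SymOfK (KInvStep Lc j) Lc (SpureAt ρ j) (M1At ρ j) (T₂ j) (M2Of mixFF j)`.  A definition. -/
def WbalAtOf (ρ : Fin (d + 1) → ℤ) (cE cVH cΛ : ℝ)
    (T₂ : ℕ → Fin (d + 1) → (Fin (d + 1) → ℤ) → Fin (d + 1) → (Fin (d + 1) → ℤ) → ExpKernelCalculus.MKer (d + 1) (Fib d))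
    (mixFF : Fin (d + 1) → (Fin (d + 1) → ℤ) → Fin (d + 1) → (Fin (d + 1) → ℤ) → ExpKernelCalculus.MKer (d + 1) (Fib d)) (j : ℕ) :
    Fin (d + 1) → (Fin (d + 1) → ℤ) → Fin (d + 1) → (Fin (d + 1) → ℤ) → ExpKernelCalculus.MKer (d + 1) (Fib d) :=
  W2SymOfK (KInvStep (d := d) Lc j) Lc (SpureAt d Lc ρ cE cVH cΛ j) (M1At d Lc ρ cΛ j) (T₂ j) (M2Of d Lc mixFF j)

variable {d Lc}

/-- [folklore] **BRIDGE:** at the corner root, `WbalAtOf 0 = BalabanStepW2.WbalOf` (same binders). -/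
theorem WbalAtOf_zero (cE cVH cΛ : ℝ)
    (T₂ : ℕ → Fin (d + 1) → (Fin (d + 1) → ℤ) → Fin (d + 1) → (Fin (d + 1) → ℤ) → ExpKernelCalculus.MKer (d + 1) (Fib d))
    (mixFF : Fin (d + 1) → (Fin (d + 1) → ℤ) → Fin (d + 1) → (Fin (d + 1) → ℤ) → ExpKernelCalculus.MKer (d + 1) (Fib d)) (j : ℕ) :
    WbalAtOf d Lc 0 cE cVH cΛ T₂ mixFF j = WbalOf d Lc cE cVH cΛ T₂ mixFF j := by
  simp only [WbalAtOf, WbalOf, SpureAt_zero, M1At_zero]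

/-- [folklore] **SWAP SYMMETRY** of every member (`SecondOrderResponse.W2SymOfK_swap`). -/
theorem WbalAtOf_swap (ρ : Fin (d + 1) → ℤ) (cE cVH cΛ : ℝ)
    (T₂ : ℕ → Fin (d + 1) → (Fin (d + 1) → ℤ) → Fin (d + 1) → (Fin (d + 1) → ℤ) → ExpKernelCalculus.MKer (d + 1) (Fib d))
    (mixFF : Fin (d + 1) → (Fin (d + 1) → ℤ) → Fin (d + 1) → (Fin (d + 1) → ℤ) → ExpKernelCalculus.MKer (d + 1) (Fib d)) (j : ℕ)
    (μ : Fin (d + 1)) (y : Fin (d + 1) → ℤ) (ν : Fin (d + 1)) (y' : Fin (d + 1) → ℤ) :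
    WbalAtOf d Lc ρ cE cVH cΛ T₂ mixFF j ν y' μ y = WbalAtOf d Lc ρ cE cVH cΛ T₂ mixFF j μ y ν y' :=
  W2SymOfK_swap _ _ _ _ _ _ μ y ν y'

/-- [folklore] **THE `loc₂` SOCKET OF THE ROOTED FAMILY** (box root): every member is a second-order vertex family at blocking `Lc` at
SOME positive rate — `vertexFamily₂_W2SymOfK'` fed with an4's `decays_KInvStep j`, `locStencil_SpureAt`, `vertexFamily_M1At` (rate `1`),
the binder hypotheses and `locStencilFM_M2Of`.  Existential at fixed `Lc`, `j`. -/
theorem vertexFamily₂_WbalAtOf' (hLc : 1 ≤ Lc) {r : Fin (d + 1) → ℕ} (hr : r ∈ box (d + 1) Lc) (cE cVH cΛ : ℝ)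
    {T₂ : ℕ → Fin (d + 1) → (Fin (d + 1) → ℤ) → Fin (d + 1) → (Fin (d + 1) → ℤ) → ExpKernelCalculus.MKer (d + 1) (Fib d)}
    {mixFF : Fin (d + 1) → (Fin (d + 1) → ℤ) → Fin (d + 1) → (Fin (d + 1) → ℤ) → ExpKernelCalculus.MKer (d + 1) (Fib d)}
    (hT₂ : ∀ j, ∃ C δ : ℝ, 0 < δ ∧ LocStencil₂ (T₂ j) C δ) (hmix : ∃ C δ : ℝ, 0 < δ ∧ LocStencilFM Lc mixFF C δ) (j : ℕ) :
    ∃ Cw δw : ℝ, 0 < δw ∧ VertexFamily₂ (WbalAtOf d Lc (toSite r) cE cVH cΛ T₂ mixFF j) Lc Cw δw := by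
  obtain ⟨Cs, δs, hδs, hS⟩ := locStencil_SpureAt (d := d) (Lc := Lc) hLc hr cE cVH cΛ j
  obtain ⟨C₂, δ₂, hδ₂, hS₂⟩ := hT₂ j
  obtain ⟨CM₂, δ₃, hδ₃, hM₂⟩ := hmix
  exact vertexFamily₂_W2SymOfK' (decays_KInvStep (Lc := Lc) (d := d) j) hS hδs (vertexFamily_M1At hLc hr cΛ j zero_le_one) one_pos
    hS₂ hδ₂ (locStencilFM_M2Of hM₂ j) hδ₃

section Choice

variable (hLc : 1 ≤ Lc) {r : Fin (d + 1) → ℕ} (hr : r ∈ box (d + 1) Lc) (cE cVH cΛ : ℝ)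
    {T₂ : ℕ → Fin (d + 1) → (Fin (d + 1) → ℤ) → Fin (d + 1) → (Fin (d + 1) → ℤ) → ExpKernelCalculus.MKer (d + 1) (Fib d)}
    {mixFF : Fin (d + 1) → (Fin (d + 1) → ℤ) → Fin (d + 1) → (Fin (d + 1) → ℤ) → ExpKernelCalculus.MKer (d + 1) (Fib d)}
    (hT₂ : ∀ j, ∃ C δ : ℝ, 0 < δ ∧ LocStencil₂ (T₂ j) C δ) (hmix : ∃ C δ : ℝ, 0 < δ ∧ LocStencilFM Lc mixFF C δ)

/-- [folklore] The packaged localisation CONSTANT of member `j` (`Classical.choose` of `vertexFamily₂_WbalAtOf'`). -/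
def CwAtOf (j : ℕ) : ℝ := (vertexFamily₂_WbalAtOf' (d := d) hLc hr cE cVH cΛ hT₂ hmix j).choose

/-- [folklore] The packaged localisation RATE of member `j`. -/
def δwAtOf (j : ℕ) : ℝ := (vertexFamily₂_WbalAtOf' (d := d) hLc hr cE cVH cΛ hT₂ hmix j).choose_spec.choose

/-- [folklore] The packaged rate is positive. -/
theorem δwAtOf_pos (j : ℕ) : 0 < δwAtOf hLc hr cE cVH cΛ hT₂ hmix j :=
  (vertexFamily₂_WbalAtOf' (d := d) hLc hr cE cVH cΛ hT₂ hmix j).choose_spec.choose_spec.1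

/-- [folklore] **THE `hW` BINDER OF `JsBalAtOf`, DISCHARGED FOR THE ROOTED FAMILY.** -/
theorem WbalAtOf_loc₂ (j : ℕ) :
    VertexFamily₂ (WbalAtOf d Lc (toSite r) cE cVH cΛ T₂ mixFF j) Lc (CwAtOf hLc hr cE cVH cΛ hT₂ hmix j)
      (δwAtOf hLc hr cE cVH cΛ hT₂ hmix j) :=
  (vertexFamily₂_WbalAtOf' (d := d) hLc hr cE cVH cΛ hT₂ hmix j).choose_spec.choose_spec.2

/-- [folklore] **BAŁABAN'S ROOTED DRESSED JET-DATA FAMILY WITH ITS SECOND-ORDER TABLES** (twin of `BalabanStepW2.JsBalW2Of`):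
`JsBalW2AtOf … := SpineRooted.JsBalAtOf hLc hr cE cVH cΛ (WbalAtOf (toSite r) …) (CwAtOf …) (δwAtOf …) (δwAtOf_pos …) (WbalAtOf_loc₂ …)`
— ONE root `toSite r` for an1's first- and second-order averaging tables AND for the axial dressing `dressAt hr`. -/
def JsBalW2AtOf : ℕ → JetData d Lc :=
  JsBalAtOf hLc hr cE cVH cΛ (WbalAtOf d Lc (toSite r) cE cVH cΛ T₂ mixFF) (CwAtOf hLc hr cE cVH cΛ hT₂ hmix)
    (δwAtOf hLc hr cE cVH cΛ hT₂ hmix) (δwAtOf_pos hLc hr cE cVH cΛ hT₂ hmix) (WbalAtOf_loc₂ hLc hr cE cVH cΛ hT₂ hmix)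

/-- [folklore] `JsBalW2AtOf` member by member: the rooted dressing of the rooted undressed member, by `rfl`. -/
theorem JsBalW2AtOf_apply (j : ℕ) :
    JsBalW2AtOf hLc hr cE cVH cΛ hT₂ hmix j
      = dressAt hr (JsBal0AtOf hLc hr cE cVH cΛ (WbalAtOf d Lc (toSite r) cE cVH cΛ T₂ mixFF) (CwAtOf hLc hr cE cVH cΛ hT₂ hmix)
          (δwAtOf hLc hr cE cVH cΛ hT₂ hmix) (δwAtOf_pos hLc hr cE cVH cΛ hT₂ hmix) (WbalAtOf_loc₂ hLc hr cE cVH cΛ hT₂ hmix) j) :=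
  rfl

/-- [folklore] The second-order slot of the UNDRESSED rooted member `j` is `WbalAtOf (toSite r) … j`. -/
theorem JsBal0W2AtOf_W (j : ℕ) :
    (JsBal0AtOf hLc hr cE cVH cΛ (WbalAtOf d Lc (toSite r) cE cVH cΛ T₂ mixFF) (CwAtOf hLc hr cE cVH cΛ hT₂ hmix)
        (δwAtOf hLc hr cE cVH cΛ hT₂ hmix) (δwAtOf_pos hLc hr cE cVH cΛ hT₂ hmix) (WbalAtOf_loc₂ hLc hr cE cVH cΛ hT₂ hmix) j).W
      = WbalAtOf d Lc (toSite r) cE cVH cΛ T₂ mixFF j :=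
  JsBal0AtOf_W hLc hr cE cVH cΛ _ _ _ _ _ j

end Choice

end Family

/-! ## §D3 Sockets of the rooted instantiated family: (Wt) and (St♭) -/

section Sockets

variable {Lc : ℕ} [NeZero Lc]

/-- [folklore] **(Wt) FOR THE ROOTED FAMILY** (all roots): if the bi-stencil tables are jointly block-covariant (`hT₂t`) and the mixed
table is jointly covariant (`hmixt`), then `WbalAtOf ρ … j μ (y + t) ν (y′ + t) = shiftK (−Lc•t) (WbalAtOf ρ … j μ y ν y′)` —
`W2SymOfK_translate` fed with `shiftK_KInvStep j`, `SpureAt_translate`, `M1At_translate`, `hT₂t j`, `M2Of_translate hmixt j`. -/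
theorem WbalAtOf_translate (ρ : Fin (d + 1) → ℤ) (hLc : 1 ≤ Lc) (cE cVH cΛ : ℝ)
    {T₂ : ℕ → Fin (d + 1) → (Fin (d + 1) → ℤ) → Fin (d + 1) → (Fin (d + 1) → ℤ) → ExpKernelCalculus.MKer (d + 1) (Fib d)}
    {mixFF : Fin (d + 1) → (Fin (d + 1) → ℤ) → Fin (d + 1) → (Fin (d + 1) → ℤ) → ExpKernelCalculus.MKer (d + 1) (Fib d)}
    (hT₂t : ∀ (j : ℕ) (κ : Fin (d + 1)) (u : Fin (d + 1) → ℤ) (κ' : Fin (d + 1)) (u' t : Fin (d + 1) → ℤ),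
      T₂ j κ (u + (Lc : ℤ) • t) κ' (u' + (Lc : ℤ) • t) = shiftK (-((Lc : ℤ) • t)) (T₂ j κ u κ' u'))
    (hmixt : ∀ (κ : Fin (d + 1)) (u : Fin (d + 1) → ℤ) (μ : Fin (d + 1)) (w t : Fin (d + 1) → ℤ),
      mixFF κ (u + (Lc : ℤ) • t) μ (w + t) = shiftK (-((Lc : ℤ) • t)) (mixFF κ u μ w))
    (j : ℕ) (μ : Fin (d + 1)) (y : Fin (d + 1) → ℤ) (ν : Fin (d + 1)) (y' t : Fin (d + 1) → ℤ) :
    WbalAtOf d Lc ρ cE cVH cΛ T₂ mixFF j μ (y + t) ν (y' + t)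
      = shiftK (-((Lc : ℤ) • t)) (WbalAtOf d Lc ρ cE cVH cΛ T₂ mixFF j μ y ν y') :=
  W2SymOfK_translate (N := Lc) (fun s => shiftK_KInvStep (Lc := Lc) (d := d) j s) (SpureAt_translate ρ hLc cE cVH cΛ j)
    (M1At_translate (Lc := Lc) ρ cΛ j) (hT₂t j) (M2Of_translate (Lc := Lc) hmixt j) μ y ν y' t

variable (hLc : 1 ≤ Lc) {r : Fin (d + 1) → ℕ} (hr : r ∈ box (d + 1) Lc) (cE cVH cΛ : ℝ)
    {T₂ : ℕ → Fin (d + 1) → (Fin (d + 1) → ℤ) → Fin (d + 1) → (Fin (d + 1) → ℤ) → ExpKernelCalculus.MKer (d + 1) (Fib d)}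
    {mixFF : Fin (d + 1) → (Fin (d + 1) → ℤ) → Fin (d + 1) → (Fin (d + 1) → ℤ) → ExpKernelCalculus.MKer (d + 1) (Fib d)}
    (hT₂ : ∀ j, ∃ C δ : ℝ, 0 < δ ∧ LocStencil₂ (T₂ j) C δ) (hmix : ∃ C δ : ℝ, 0 < δ ∧ LocStencilFM Lc mixFF C δ)

/-- [folklore] **(St♭) FOR THE ROOTED INSTANTIATED DRESSED FAMILY**, every member (`SpineRooted.JsBalAtOf_S_translate`). -/
theorem JsBalW2AtOf_S_translate (j : ℕ) (κ' : Fin (d + 1)) (u t : Fin (d + 1) → ℤ) :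
    (JsBalW2AtOf hLc hr cE cVH cΛ hT₂ hmix j).S κ' (u + (Lc : ℤ) • t)
      = shiftK (-((Lc : ℤ) • t)) ((JsBalW2AtOf hLc hr cE cVH cΛ hT₂ hmix j).S κ' u) :=
  JsBalAtOf_S_translate hLc hr cE cVH cΛ _ _ _ _ _ j κ' u t

/-- [folklore] **(Wt) FOR THE ROOTED INSTANTIATED DRESSED FAMILY**, every member, from the joint covariance of the two binder tables
(`WbalAtOf_translate` into `SpineRooted.JsBalAtOf_W_translate`). -/
theorem JsBalW2AtOf_W_translate
    (hT₂t : ∀ (j : ℕ) (κ : Fin (d + 1)) (u : Fin (d + 1) → ℤ) (κ' : Fin (d + 1)) (u' t : Fin (d + 1) → ℤ),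
      T₂ j κ (u + (Lc : ℤ) • t) κ' (u' + (Lc : ℤ) • t) = shiftK (-((Lc : ℤ) • t)) (T₂ j κ u κ' u'))
    (hmixt : ∀ (κ : Fin (d + 1)) (u : Fin (d + 1) → ℤ) (μ : Fin (d + 1)) (w t : Fin (d + 1) → ℤ),
      mixFF κ (u + (Lc : ℤ) • t) μ (w + t) = shiftK (-((Lc : ℤ) • t)) (mixFF κ u μ w))
    (j : ℕ) (μ : Fin (d + 1)) (y : Fin (d + 1) → ℤ) (ν : Fin (d + 1)) (y' t : Fin (d + 1) → ℤ) :
    (JsBalW2AtOf hLc hr cE cVH cΛ hT₂ hmix j).W μ (y + t) ν (y' + t)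
      = shiftK (-((Lc : ℤ) • t)) ((JsBalW2AtOf hLc hr cE cVH cΛ hT₂ hmix j).W μ y ν y') :=
  JsBalAtOf_W_translate hLc hr cE cVH cΛ _ _ _ _ _ (WbalAtOf_translate (toSite r) hLc cE cVH cΛ hT₂t hmixt) j μ y ν y' t

end Sockets

end Summit.QuantumFields.BalabanUV.Beta.SpineRooted

end
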